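import Summits.QuantumFields.YangMills.Theorems.IR.PurityChannelAnchorTube
import Summits.QuantumFields.YangMills.Theorems.IR.PurityChannelDefs
import Literature.MathematicalPhysics.QuantumFieldTheory.PeriodicBoxPartitionFunction
import HarnessLib

/-!
# Crux `IR` (stmt-QuantumFields-19354) — purity-channel family: the located supplier `ComplexAnchor` PROVED

Helper module for item `stmt-QuantumFields-19354` (`--supports … --as helper`; it closes no item: `ComplexAnchor` is the
shared LOCATED SUPPLIER of the two conditional lines `harmonic-purity-channel` / `jensen-purity-channel` of ideator
ym-ir-idea-16, typed in `Theorems/IR/PurityChannelDefs.lean` (p638853) and consumed by the seams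
`coldExitSC_of_channel[_twoConstants]` (p639233) / `coldExitSC_of_sparse[_poissonJensen]` (p639500)).

`complexAnchor_holds : ComplexAnchor` — there are absolute constants `ε₀ = 1/(2e²(16·4²+1)²)`, `C = 48e`, `c = 1/8` and an
`L₀` such that for every compact metrisable group `G` and every continuous complex plaquette weight `w` with
`‖w − 1‖∞ ≤ ε₀`, for all `L ≥ L₀` the cold-torus partition function `Z[w](L³×⌊L/4⌋)` is non-zero and the purity ratio obeys
`‖1 − h_L[w]‖ ≤ C L⁴ e^{−cL}`.  Proof (Kotecký–Preiss for the plaquette gas with activity `w − 1`, Seiler LNP 159 Ch. 3):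

* §1 the weight factors `U ↦ w(U_p) − 1` on the labels of the periodic boxes (`PeriodicBoxPlaqSystem`: holonomy read through
  the section `BoxSite.toEdge`) are measurable, depend only on the four bonds of the label, are covariant under the
  translations `BoxLabel.rot` and compatible with the inclusions `BoxLabel.castLE` on non-wrapping labels (the tree's
  `measurable_boxCost` / `dependsOn_cost` / `cost_rot` / `cost_castLE`, weight-free);
* §2 the dictionary `Z[w](n₀,n₁,n₂,n₃) = pertZ ν (w(U_p) − 1) univ` with the `Fin`-torus spelling of `PurityChannelDefs`
  (the tree's `boxSystem_partZ_univ_eq_finTorus`, weight-free);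
* §3 assembly: zero-freeness (`pertZ_ne_zero_of_factors`), `h_L = exp(log Z(2t) − 2 log Z(t))`
  (`exp_pertLogZ_of_factors`), the two-tube bound `‖log Z(L³×2t) − 2 log Z(L³×t)‖ ≤ 24 L³ t e^{−⌊t/2⌋}`
  (`norm_pertLogZ_two_tubes_le_of_covariant`: the bulk `t·E_m` cancels), `t = ⌊L/4⌋`, `⌊t/2⌋ = ⌊L/8⌋ ≥ L/8 − 1`, and
  `‖e^δ − 1‖ ≤ 2‖δ‖` for `‖δ‖ ≤ 1` (`L₀` from `L⁴e^{−L/8} → 0`).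

Everything is proved; no definitions; no named facts; axioms standard.

HONEST FRAMING: this discharges the located strong-coupling ANCHOR of the purity-channel family only (complex small-activity
bookkeeping, group-blind — it holds verbatim for `U(1)` and finite groups); the family's LOADS `PurityChannel` /
`SparseChannel` are the infrared wall re-typed (crit-4: width 0) and remain OPEN, as do `IR` (19354), `IRcof` (26930),
confinement, a lattice gap and the Yang–Mills mass gap (Clay), none of which is proved here; `R4` closes only the conditional
finite-𝕋⁴ rung `BalabanLadder.UV`.
-/

set_option autoImplicit false

noncomputable section

open MeasureTheory ProbabilityTheory Finset Filter Topology
open Literature.Probability.LatticeModels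
open Literature.MathematicalPhysics.QuantumFieldTheory

namespace Summit.QuantumFields.YangMills.Cruxes.IR.PurityChannelFamily

-- `G : Type` (universe 0) as in `PurityChannelDefs.weightFinTorusPartition` / `ComplexAnchor`
variable {G : Type} [Group G] [TopologicalSpace G] [IsTopologicalGroup G] [CompactSpace G]
  [MeasurableSpace G] [BorelSpace G]

/-! ## §1 The weight factors `w(U_p) − 1` on the labels of a periodic box -/

section Factors

variable {d : ℕ} {n n' : Fin d → ℕ}

omit [CompactSpace G] in
/-- The plaquette holonomy of a box label, read through the section, is a measurable function of the configuration
(second-countable `G`: the group operations are jointly measurable). [folklore] -/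
theorem measurable_boxHolonomy [SecondCountableTopology G] (p : BoxLabel n) :
    Measurable fun U : ZdGaugeConfig d G =>
      U (BoxSite.toEdge p.1 p.2.1.1) * U (BoxSite.toEdge (BoxSite.shift p.2.1.1 p.1) p.2.1.2) *
        (U (BoxSite.toEdge (BoxSite.shift p.2.1.2 p.1) p.2.1.1))⁻¹ * (U (BoxSite.toEdge p.1 p.2.1.2))⁻¹ := by
  fun_prop

omit [CompactSpace G] in
/-- The weight factor `U ↦ k(U_p)` of a measurable `k : G → ℂ` is measurable. [folklore] -/
theorem measurable_weightFactor [SecondCountableTopology G] {k : G → ℂ} (hk : Measurable k) (p : BoxLabel n) :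
    Measurable fun U : ZdGaugeConfig d G =>
      k (U (BoxSite.toEdge p.1 p.2.1.1) * U (BoxSite.toEdge (BoxSite.shift p.2.1.1 p.1) p.2.1.2) *
        (U (BoxSite.toEdge (BoxSite.shift p.2.1.2 p.1) p.2.1.1))⁻¹ * (U (BoxSite.toEdge p.1 p.2.1.2))⁻¹) :=
  hk.comp (measurable_boxHolonomy p)

omit [TopologicalSpace G] [IsTopologicalGroup G] [CompactSpace G] [MeasurableSpace G] [BorelSpace G] in
/-- The weight factor of a label depends only on its four bonds (the tree's `BoxLabel.dependsOn_cost`, weight-free).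
[folklore] -/
theorem dependsOn_weightFactor (k : G → ℂ) (p : BoxLabel n) :
    DependsOn (fun U : ZdGaugeConfig d G =>
      k (U (BoxSite.toEdge p.1 p.2.1.1) * U (BoxSite.toEdge (BoxSite.shift p.2.1.1 p.1) p.2.1.2) *
        (U (BoxSite.toEdge (BoxSite.shift p.2.1.2 p.1) p.2.1.1))⁻¹ * (U (BoxSite.toEdge p.1 p.2.1.2))⁻¹))
      ((p.bonds : Finset (ZdEdge d)) : Set (ZdEdge d)) := by
  intro U V h
  simp only
  rw [h _ (by simp [BoxLabel.bonds]), h (BoxSite.toEdge (BoxSite.shift p.2.1.1 p.1) p.2.1.2) (by simp [BoxLabel.bonds]),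
    h (BoxSite.toEdge (BoxSite.shift p.2.1.2 p.1) p.2.1.1) (by simp [BoxLabel.bonds]),
    h (BoxSite.toEdge p.1 p.2.1.2) (by simp [BoxLabel.bonds])]

omit [TopologicalSpace G] [IsTopologicalGroup G] [CompactSpace G] [MeasurableSpace G] [BorelSpace G] in
/-- **Translation covariance**: the weight factor of a rotated label is the weight factor read through the bond
relabelling `boxEdgeRot` (the tree's `BoxLabel.cost_rot`, weight-free). [Seiler LNP 159 Ch. 2] -/
theorem weightFactor_rot (k : G → ℂ) (i : Fin d) (s : ℕ) (p : BoxLabel n) (U : ZdGaugeConfig d G) :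
    (fun (p : BoxLabel n) (U : ZdGaugeConfig d G) =>
      k (U (BoxSite.toEdge p.1 p.2.1.1) * U (BoxSite.toEdge (BoxSite.shift p.2.1.1 p.1) p.2.1.2) *
        (U (BoxSite.toEdge (BoxSite.shift p.2.1.2 p.1) p.2.1.1))⁻¹ * (U (BoxSite.toEdge p.1 p.2.1.2))⁻¹))
        (BoxLabel.rot i s p) U =
      (fun (p : BoxLabel n) (U : ZdGaugeConfig d G) =>
      k (U (BoxSite.toEdge p.1 p.2.1.1) * U (BoxSite.toEdge (BoxSite.shift p.2.1.1 p.1) p.2.1.2) *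
        (U (BoxSite.toEdge (BoxSite.shift p.2.1.2 p.1) p.2.1.1))⁻¹ * (U (BoxSite.toEdge p.1 p.2.1.2))⁻¹))
        p (U ∘ boxEdgeRot n i s) := by
  simp only [BoxLabel.rot, BoxSite.shift_rot, BoxSite.toEdge_rot, Function.comp_apply]

omit [TopologicalSpace G] [IsTopologicalGroup G] [CompactSpace G] [MeasurableSpace G] [BorelSpace G] in
/-- **Compatibility with the inclusion of boxes**: for sizes `n ≤ n'` and a label `p` of the smaller box such that in every
direction either `p` does not sit on the last slice or the two sizes agree, the weight factor of `castLE p` in the box `n'`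
is the weight factor of `p` in the box `n` (the tree's `BoxLabel.cost_castLE`, weight-free). [Seiler LNP 159 Ch. 2] -/
theorem weightFactor_castLE (k : G → ℂ) (h : ∀ i, n i ≤ n' i) (p : BoxLabel n)
    (hdir : ∀ μ : Fin d, ((p.1 μ : ℕ) + 1 < n μ) ∨ n μ = n' μ) (U : ZdGaugeConfig d G) :
    (fun (p : BoxLabel n') (U : ZdGaugeConfig d G) =>
      k (U (BoxSite.toEdge p.1 p.2.1.1) * U (BoxSite.toEdge (BoxSite.shift p.2.1.1 p.1) p.2.1.2) *
        (U (BoxSite.toEdge (BoxSite.shift p.2.1.2 p.1) p.2.1.1))⁻¹ * (U (BoxSite.toEdge p.1 p.2.1.2))⁻¹))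
        (BoxLabel.castLE h p) U =
      (fun (p : BoxLabel n) (U : ZdGaugeConfig d G) =>
      k (U (BoxSite.toEdge p.1 p.2.1.1) * U (BoxSite.toEdge (BoxSite.shift p.2.1.1 p.1) p.2.1.2) *
        (U (BoxSite.toEdge (BoxSite.shift p.2.1.2 p.1) p.2.1.1))⁻¹ * (U (BoxSite.toEdge p.1 p.2.1.2))⁻¹))
        p U := by
  simp only [BoxLabel.castLE, ← BoxSite.castLE_shift h (hdir _), BoxSite.toEdge_castLE]

end Factors

/-! ## §2 The dictionary with the `Fin`-torus partition function of `PurityChannelDefs` -/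

section Dictionary

/-- **`Z[w]` of the `Fin`-indexed four-torus is the perturbed partition function of the weight factors `w(U_p) − 1` on the
box system** `boxSystem · ![n₀,n₁,n₂,n₃]` realised in the Haar product `zdHaar 4 G`:
`Z[w](n₀,n₁,n₂,n₃) = ∫ ∏_p (1 + (w(U_p) − 1)) dν` — read the `ℤ⁴`-configuration on the sections of the box bonds
(`map_comp_toEdge_zdHaar`) and reindex the sites along `x ↦ (x 0, x 1, x 2, x 3)`, which intertwines the shifts (the
tree's `boxSystem_partZ_univ_eq_finTorus`, weight-free). [Montvay–Münster 1994 §3.2.6 (3.145)] -/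
theorem weightFinTorusPartition_eq_pertZ [SecondCountableTopology G] {w : G → ℂ} (hw : Measurable w)
    (n₀ n₁ n₂ n₃ : ℕ) :
    weightFinTorusPartition w n₀ n₁ n₂ n₃ =
      pertZ (zdHaar 4 G) (fun (p : BoxLabel (![n₀, n₁, n₂, n₃] : Fin 4 → ℕ)) (U : ZdGaugeConfig 4 G) =>
        w (U (BoxSite.toEdge p.1 p.2.1.1) * U (BoxSite.toEdge (BoxSite.shift p.2.1.1 p.1) p.2.1.2) *
          (U (BoxSite.toEdge (BoxSite.shift p.2.1.2 p.1) p.2.1.1))⁻¹ * (U (BoxSite.toEdge p.1 p.2.1.2))⁻¹) - 1)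
        Finset.univ := by
  set n : Fin 4 → ℕ := ![n₀, n₁, n₂, n₃] with hn
  -- the integrand on box configurations
  set Φ : (BoxSite n × Fin 4 → G) → ℂ := fun V => ∏ p : BoxLabel n,
      w (V (p.1, p.2.1.1) * V (BoxSite.shift p.2.1.1 p.1, p.2.1.2) *
        (V (BoxSite.shift p.2.1.2 p.1, p.2.1.1))⁻¹ * (V (p.1, p.2.1.2))⁻¹) with hΦ
  have hΦm : Measurable Φ := by
    refine Finset.measurable_prod _ fun p _ => hw.comp ?_
    fun_prop
  have hcomp : ∀ U : ZdGaugeConfig 4 G,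
      ∏ p ∈ (Finset.univ : Finset (BoxLabel n)),
        (1 + (w (U (BoxSite.toEdge p.1 p.2.1.1) * U (BoxSite.toEdge (BoxSite.shift p.2.1.1 p.1) p.2.1.2) *
          (U (BoxSite.toEdge (BoxSite.shift p.2.1.2 p.1) p.2.1.1))⁻¹ * (U (BoxSite.toEdge p.1 p.2.1.2))⁻¹) - 1)) =
        Φ (fun l => U (BoxSite.toEdge l.1 l.2)) := by
    intro U
    simp only [hΦ, add_sub_cancel]
  -- step 1: `pertZ = ∫ Φ` over the finite Haar product of the box bonds
  have h1 : pertZ (zdHaar 4 G) (fun (p : BoxLabel n) (U : ZdGaugeConfig 4 G) =>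
        w (U (BoxSite.toEdge p.1 p.2.1.1) * U (BoxSite.toEdge (BoxSite.shift p.2.1.1 p.1) p.2.1.2) *
          (U (BoxSite.toEdge (BoxSite.shift p.2.1.2 p.1) p.2.1.1))⁻¹ * (U (BoxSite.toEdge p.1 p.2.1.2))⁻¹) - 1)
        Finset.univ =
      ∫ V, Φ V ∂(Measure.pi fun _ : BoxSite n × Fin 4 => haarProbability G) := by
    unfold pertZ
    calc ∫ U, ∏ p ∈ (Finset.univ : Finset (BoxLabel n)),
          (1 + (w (U (BoxSite.toEdge p.1 p.2.1.1) * U (BoxSite.toEdge (BoxSite.shift p.2.1.1 p.1) p.2.1.2) *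
            (U (BoxSite.toEdge (BoxSite.shift p.2.1.2 p.1) p.2.1.1))⁻¹ * (U (BoxSite.toEdge p.1 p.2.1.2))⁻¹) - 1))
          ∂(zdHaar 4 G)
        = ∫ U, Φ (fun l => U (BoxSite.toEdge l.1 l.2)) ∂(zdHaar 4 G) :=
          integral_congr_ae (Filter.Eventually.of_forall hcomp)
      _ = ∫ V, Φ V ∂((zdHaar 4 G).map fun (U : ZdGaugeConfig 4 G) (l : BoxSite n × Fin 4) =>
            U (BoxSite.toEdge l.1 l.2)) := by
          rw [integral_map (measurable_pi_lambda _ fun l => measurable_pi_apply _).aemeasurable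
            hΦm.aestronglyMeasurable]
      _ = ∫ V, Φ V ∂(Measure.pi fun _ : BoxSite n × Fin 4 => haarProbability G) := by
          rw [map_comp_toEdge_zdHaar]
  rw [h1]
  -- step 2: the site bijection and its compatibility with the shifts
  let eS : BoxSite n ≃ FinTorusSite n₀ n₁ n₂ n₃ :=
    { toFun := fun x => (x 0, x 1, x 2, x 3)
      invFun := fun y => Fin.cons y.1 (Fin.cons y.2.1 (Fin.cons y.2.2.1 (Fin.cons y.2.2.2 finZeroElim)))
      left_inv := fun x => by funext i; fin_cases i <;> rfl
      right_inv := fun y => rfl }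
  have heS : ∀ (x : BoxSite n) (μ : Fin 4), eS (BoxSite.shift μ x) = (eS x).shift μ := by
    intro x μ
    fin_cases μ
    · show ((Function.update x 0 _ 0), (Function.update x 0 _ 1), (Function.update x 0 _ 2),
        (Function.update x 0 _ 3)) = _
      simp only [Function.update_self, ne_eq, Fin.reduceEq, not_false_eq_true, Function.update_of_ne]
      rfl
    · show ((Function.update x 1 _ 0), (Function.update x 1 _ 1), (Function.update x 1 _ 2),
        (Function.update x 1 _ 3)) = _
      simp only [Function.update_self, ne_eq, Fin.reduceEq, not_false_eq_true, Function.update_of_ne]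
      rfl
    · show ((Function.update x 2 _ 0), (Function.update x 2 _ 1), (Function.update x 2 _ 2),
        (Function.update x 2 _ 3)) = _
      simp only [Function.update_self, ne_eq, Fin.reduceEq, not_false_eq_true, Function.update_of_ne]
      rfl
    · show ((Function.update x 3 _ 0), (Function.update x 3 _ 1), (Function.update x 3 _ 2),
        (Function.update x 3 _ 3)) = _
      simp only [Function.update_self, ne_eq, Fin.reduceEq, not_false_eq_true, Function.update_of_ne]
      rfl
  -- reindex the bond variables
  let ε : (BoxSite n × Fin 4) ≃ (FinTorusSite n₀ n₁ n₂ n₃ × Fin 4) := eS.prodCongr (Equiv.refl (Fin 4))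
  let Ψ : (FinTorusSite n₀ n₁ n₂ n₃ × Fin 4 → G) ≃ᵐ (BoxSite n × Fin 4 → G) :=
    (MeasurableEquiv.piCongrLeft (fun _ : FinTorusSite n₀ n₁ n₂ n₃ × Fin 4 => G) ε).symm
  have hΨ : MeasurePreserving Ψ (Measure.pi fun _ : FinTorusSite n₀ n₁ n₂ n₃ × Fin 4 => haarProbability G)
      (Measure.pi fun _ : BoxSite n × Fin 4 => haarProbability G) :=
    (measurePreserving_piCongrLeft (fun _ : FinTorusSite n₀ n₁ n₂ n₃ × Fin 4 => haarProbability G) ε).symm _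
  have hΨapply : ∀ (U : FinTorusSite n₀ n₁ n₂ n₃ × Fin 4 → G) (l : BoxSite n × Fin 4),
      Ψ U l = U (eS l.1, l.2) := fun U l => rfl
  unfold weightFinTorusPartition
  rw [← hΨ.integral_comp']
  refine integral_congr_ae (Filter.Eventually.of_forall fun U => ?_)
  -- compare the integrands (box side on the left, so that the reindexing rewrites hit the right products)
  symm
  simp only [hΦ, hΨapply]
  rw [Fintype.prod_prod_type, ← Equiv.prod_comp eS]
  refine Finset.prod_congr rfl fun x _ => Finset.prod_congr rfl fun q _ => ?_
  simp only [finTorusPlaquette, heS]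

end Dictionary

/-! ## §3 Assembly: `ComplexAnchor` -/

section Assembly

/-- The elementary floor estimate `L/8 − 1 ≤ ⌊⌊L/4⌋/2⌋`. [folklore] -/
theorem div_four_div_two_ge (L : ℕ) : (L : ℝ) / 8 - 1 ≤ ((L / 4 / 2 : ℕ) : ℝ) := by
  rw [Nat.div_div_eq_div_mul]
  have h1 : (8 : ℝ) * ((L / 8 : ℕ) : ℝ) + ((L % 8 : ℕ) : ℝ) = L := by exact_mod_cast Nat.div_add_mod L 8
  have h2 : ((L % 8 : ℕ) : ℝ) < 8 := by exact_mod_cast Nat.mod_lt L (by norm_num)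
  linarith

/-- There is a threshold beyond which `24 e · L⁴ e^{−L/8} ≤ 1` (`x⁴ e^{−x} → 0`). [folklore] -/
theorem exists_threshold_pow_four_exp :
    ∃ L₁ : ℕ, ∀ L : ℕ, L₁ ≤ L → 24 * Real.exp 1 * (L : ℝ) ^ 4 * Real.exp (-((1 / 8 : ℝ) * L)) ≤ 1 := by
  -- `x ↦ x⁴ e^{−x}` tends to `0`; rescale `x = L/8`
  have h0 : Tendsto (fun x : ℝ => x ^ 4 * Real.exp (-x)) atTop (𝓝 0) :=
    Real.tendsto_pow_mul_exp_neg_atTop_nhds_zero 4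
  have h8 : Tendsto (fun L : ℕ => ((L : ℝ) / 8)) atTop atTop :=
    (tendsto_natCast_atTop_atTop.atTop_div_const (by norm_num : (0 : ℝ) < 8))
  have h1 : Tendsto (fun L : ℕ => (24 * Real.exp 1 * 8 ^ 4) * (((L : ℝ) / 8) ^ 4 * Real.exp (-((L : ℝ) / 8))))
      atTop (𝓝 ((24 * Real.exp 1 * 8 ^ 4) * 0)) :=
    (h0.comp h8).const_mul _
  rw [mul_zero] at h1
  have hev := h1.eventually (gt_mem_nhds (show (0 : ℝ) < 1 by norm_num))
  obtain ⟨L₁, hL₁⟩ := Filter.eventually_atTop.1 hev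
  refine ⟨L₁, fun L hL => ?_⟩
  have h := (hL₁ L hL).le
  have e : (24 * Real.exp 1 * 8 ^ 4) * (((L : ℝ) / 8) ^ 4 * Real.exp (-((L : ℝ) / 8))) =
      24 * Real.exp 1 * (L : ℝ) ^ 4 * Real.exp (-((1 / 8 : ℝ) * L)) := by
    rw [show -((1 / 8 : ℝ) * L) = -((L : ℝ) / 8) by ring]
    ring
  rwa [e] at h

/-- **The located supplier `ComplexAnchor` of the purity-channel family holds.**  With `ε₀ = 1/(2e²(16·4²+1)²)`,
`C = 48e`, `c = 1/8` and a suitable `L₀`: for every compact metrisable group `G` and every continuous complex plaquette weight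
`w` with `‖w − 1‖∞ ≤ ε₀`, for all `L ≥ L₀` the cold-torus partition function `Z[w](L³×⌊L/4⌋)` is non-zero and
`‖1 − h_L[w]‖ ≤ C L⁴ e^{−cL}` (Kotecký–Preiss expansion of the plaquette gas with activity `w − 1`: zero-freeness by
Dobrushin's criterion; `h_L = exp(log Z(2t) − 2 log Z(t))` and the bulk `t·E_{⌊t/2⌋}` cancels, leaving the tails
`24 L³ t e^{−⌊t/2⌋}`, `t = ⌊L/4⌋`). [Seiler LNP 159 (1982) Ch. 3; Kotecký–Preiss 1986 Theorem p. 492] -/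
theorem complexAnchor_holds : ComplexAnchor := by
  -- the absolute constants
  set ε₀ : ℝ := 1 / (2 * Real.exp 2 * ((boxDeg 4 : ℝ) + 1) ^ 2) with hε₀_def
  have hε₀ : 0 < ε₀ := by rw [hε₀_def]; positivity
  have hε2 : Real.exp 2 * ε₀ * ((boxDeg 4 : ℝ) + 1) ^ 2 ≤ 1 / 2 := by
    rw [hε₀_def]
    have : 0 < Real.exp 2 := Real.exp_pos 2
    exact le_of_eq (by field_simp)
  have hε1 : Real.exp 1 * ε₀ * ((boxDeg 4 : ℝ) + 1) ^ 2 ≤ 1 / 2 := smallness_one_of_two' hε₀.le hε2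
  obtain ⟨L₁, hL₁⟩ := exists_threshold_pow_four_exp
  refine ⟨ε₀, 48 * Real.exp 1, 1 / 8, hε₀, by norm_num, max L₁ 4, ?_⟩
  intro G _ _ _ _ _ _ _ w hw hw1 L hL
  have hL₁L : L₁ ≤ L := le_trans (le_max_left _ _) hL
  have hL4 : 4 ≤ L := le_trans (le_max_right _ _) hL
  have hLpos : 0 < L := by omega
  -- the time extent of the cold torus
  set t : ℕ := L / 4 with ht_def
  have ht : 1 ≤ t := by rw [ht_def]; omega
  -- the adjacency structure of the box systems (representation-independent): use the trivial representation
  set ρ₁ : G →* Matrix (Fin 1) (Fin 1) ℂ := 1 with hρ₁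
  -- the size-indexed family of weight factors `w(U_p) − 1`
  set f : (n : Fin 4 → ℕ) → BoxLabel n → ZdGaugeConfig 4 G → ℂ := fun n p U =>
    w (U (BoxSite.toEdge p.1 p.2.1.1) * U (BoxSite.toEdge (BoxSite.shift p.2.1.1 p.1) p.2.1.2) *
      (U (BoxSite.toEdge (BoxSite.shift p.2.1.2 p.1) p.2.1.1))⁻¹ * (U (BoxSite.toEdge p.1 p.2.1.2))⁻¹) - 1 with hf
  have hwm : Measurable fun g : G => w g - 1 := hw.measurable.sub measurable_const
  have hmeas : ∀ (n : Fin 4 → ℕ) (p : BoxLabel n), Measurable (f n p) := fun n p =>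
    measurable_weightFactor (k := fun g => w g - 1) hwm p
  have hdep : ∀ (n : Fin 4 → ℕ) (p : BoxLabel n),
      DependsOn (f n p) ((p.bonds : Finset (ZdEdge 4)) : Set (ZdEdge 4)) := fun n p =>
    dependsOn_weightFactor (fun g => w g - 1) p
  have hnorm : ∀ (n : Fin 4 → ℕ) (p : BoxLabel n) (U : ZdGaugeConfig 4 G), ‖f n p U‖ ≤ ε₀ := fun n p U => hw1 _
  have hrot : ∀ (n : Fin 4 → ℕ) (s : ℕ) (p : BoxLabel n) (U : ZdGaugeConfig 4 G),
      f n (BoxLabel.rot 3 s p) U = f n p (U ∘ boxEdgeRot n 3 s) := fun n s p U =>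
    weightFactor_rot (fun g => w g - 1) 3 s p U
  have hcompat : ∀ (n n' : Fin 4 → ℕ) (h : ∀ i, n i ≤ n' i) (p : BoxLabel n),
      (∀ μ : Fin 4, ((p.1 μ : ℕ) + 1 < n μ) ∨ n μ = n' μ) →
        ∀ U : ZdGaugeConfig 4 G, f n' (BoxLabel.castLE h p) U = f n p U := fun n n' h p hdir U =>
    weightFactor_castLE (fun g => w g - 1) h p hdir U
  -- the dictionary with the `Fin`-torus partition functions of the purity ratio
  have hZ : ∀ s : ℕ, weightFinTorusPartition w L L L s =
      pertZ (zdHaar 4 G) (f (![L, L, L, s] : Fin 4 → ℕ)) Finset.univ := fun s =>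
    weightFinTorusPartition_eq_pertZ hw.measurable L L L s
  have hne : ∀ s : ℕ, pertZ (zdHaar 4 G) (f (![L, L, L, s] : Fin 4 → ℕ)) Finset.univ ≠ 0 := fun s =>
    pertZ_ne_zero_of_factors hε₀.le (hmeas _) (hdep _) (hnorm _) hε1 _
  refine ⟨by rw [hZ]; exact hne t, ?_⟩
  -- the purity ratio as the exponential of the two-tube combination of Kotecký–Preiss logarithms
  set A := pertLogZ (zdHaar 4 G) (f (![L, L, L, t] : Fin 4 → ℕ))
    (boxSystem (G := G) ρ₁ (![L, L, L, t] : Fin 4 → ℕ)).Adj Finset.univ with hA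
  set B := pertLogZ (zdHaar 4 G) (f (![L, L, L, 2 * t] : Fin 4 → ℕ))
    (boxSystem (G := G) ρ₁ (![L, L, L, 2 * t] : Fin 4 → ℕ)).Adj Finset.univ with hB
  have hexpA : Complex.exp A = pertZ (zdHaar 4 G) (f (![L, L, L, t] : Fin 4 → ℕ)) Finset.univ :=
    exp_pertLogZ_of_factors (ρ := ρ₁) hε₀.le (hmeas _) (hdep _) (hnorm _) hε1 _
  have hexpB : Complex.exp B = pertZ (zdHaar 4 G) (f (![L, L, L, 2 * t] : Fin 4 → ℕ)) Finset.univ :=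
    exp_pertLogZ_of_factors (ρ := ρ₁) hε₀.le (hmeas _) (hdep _) (hnorm _) hε1 _
  have hratio : purityRatio w L = Complex.exp (B - 2 * A) := by
    unfold purityRatio
    rw [hZ, hZ, ← hexpA, ← hexpB, Complex.exp_sub, two_mul, Complex.exp_add, sq]
  -- the two-tube bound and the elementary majorisation
  have hδ : ‖B - 2 * A‖ ≤ 24 * (L : ℝ) ^ 3 * t * Real.exp (-((t / 2 : ℕ) : ℝ)) :=
    norm_pertLogZ_two_tubes_le_of_covariant (ρ := ρ₁) hε₀.le hmeas hdep hnorm hε2 hrot hcompat hLpos ht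
  have htL : (t : ℝ) ≤ L := by exact_mod_cast Nat.div_le_self L 4
  have hfloor : Real.exp (-((t / 2 : ℕ) : ℝ)) ≤ Real.exp 1 * Real.exp (-((1 / 8 : ℝ) * L)) := by
    rw [← Real.exp_add]
    refine Real.exp_le_exp.2 ?_
    have := div_four_div_two_ge L
    rw [ht_def]
    linarith
  have hδ' : ‖B - 2 * A‖ ≤ 24 * Real.exp 1 * (L : ℝ) ^ 4 * Real.exp (-((1 / 8 : ℝ) * L)) := by
    refine hδ.trans ?_
    have hL0 : (0 : ℝ) ≤ L := Nat.cast_nonneg L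
    calc 24 * (L : ℝ) ^ 3 * t * Real.exp (-((t / 2 : ℕ) : ℝ))
        ≤ 24 * (L : ℝ) ^ 3 * L * (Real.exp 1 * Real.exp (-((1 / 8 : ℝ) * L))) := by gcongr
      _ = 24 * Real.exp 1 * (L : ℝ) ^ 4 * Real.exp (-((1 / 8 : ℝ) * L)) := by ring
  have hδ1 : ‖B - 2 * A‖ ≤ 1 := hδ'.trans (hL₁ L hL₁L)
  rw [hratio, norm_sub_rev]
  calc ‖Complex.exp (B - 2 * A) - 1‖ ≤ 2 * ‖B - 2 * A‖ := Complex.norm_exp_sub_one_le hδ1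
    _ ≤ 2 * (24 * Real.exp 1 * (L : ℝ) ^ 4 * Real.exp (-((1 / 8 : ℝ) * L))) := by gcongr
    _ = 48 * Real.exp 1 * (L : ℝ) ^ 4 * Real.exp (-((1 / 8 : ℝ) * L)) := by ring

end Assembly

end Summit.QuantumFields.YangMills.Cruxes.IR.PurityChannelFamily

end
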